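import Literature.InformationTheory.QuantumCodes.PauliNoise
import Literature.InformationTheory.QuantumCodes.Pauli
import Literature.InformationTheory.QuantumCodes.SyndromeDecodingCSS
import Literature.InformationTheory.QuantumCodes.MinWeightDecodingClusters
import Literature.InformationTheory.QuantumCodes.ClusterCountingBound
import HarnessLib

/-!
# Sector-wise decoding of a CSS code under i.i.d. DEPOLARIZING noise: the two marginals are
# independent flips of rate `2p/3`, and `P_fail^depol(p) ≤ P_fail^X(2p/3) + P_fail^Z(2p/3)`

Topic `Literature/InformationTheory/QuantumCodes` (venture QEC, LADDER-QEC rung Q5, PARTITION row 09 "noise models: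
i.i.d. depolarising"; qec-type-09 gen 3). PROVED, elementary probability, no named fact, kernel axioms. The
depolarizing channel of rate `p` (`PauliNoise.lean`: `depolarizingLaw p`, each of `X, Y, Z` with probability
`p/3`) acts independently on the qubits of a CSS code `C : CSSCode RX RZ Q`; the code is decoded SECTOR-WISE
("recovery from `X` errors and `Z` errors separately", Dennis–Kitaev–Landahl–Preskill §4.1; Dumer–Kovalev–Pryadko
eq. (succesful-decoding-depolarizing)): a decoder `DX` of the `Z`-syndrome `H^Z x` acts on the bit-flip part
`x = (xBit ∘ E)` of the Pauli error `E`, a decoder `DZ` of the `X`-syndrome on the phase-flip part `z = (zBit ∘ E)`,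
and recovery SUCCEEDS iff both residuals are stabilizer parts: `DX(H^Z x) + x ∈ rs H^X` and `DZ(H^X z) + z ∈ rs H^Z`
(the stabilizer group of a CSS code is `{X(a)Z(b) : a ∈ rs H^X, b ∈ rs H^Z}` up to phase).

* `depolarizingProb p E = ∏_q (E_q = I ? 1-p : p/3)` — the mass of the string `E` under i.i.d. depolarizing noise,
  as a real; `toReal_iidLaw_depolarizingLaw` identifies it with the `PMF` `iidLaw (depolarizingLaw p)`.
* MARGINALS (`sum_depolarizingProb_xBit_mem`, `sum_depolarizingProb_zBit_mem`): for every set `A` of bit patterns,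
  `Σ_{E : xBit∘E ∈ A} depolarizingProb p E = Σ_{x ∈ A} bernoulliWeight (2p/3) (supp x)` — the bit-flip part of a
  depolarizing error is a pattern of INDEPENDENT flips of rate `2p/3` (`P(E_q ∈ {X,Y}) = 2p/3`), and likewise the
  phase-flip part (`P(E_q ∈ {Y,Z}) = 2p/3`); exact, by `Finset.prod_univ_sum`.
* `CSSCode.depolarizingFailureProb C DX DZ p` (definition) and the UNION BOUND
  `CSSCode.depolarizingFailureProb_le`: `P_fail^depol(p) ≤ Σ_{x : DX fails} bernoulliWeight (2p/3) (supp x) +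
  Σ_{z : DZ fails} bernoulliWeight (2p/3) (supp z)` for `0 ≤ p ≤ 1` — the right-hand side is exactly the pair of
  one-sector code-capacity failure probabilities of the tree (`CSSFiniteSizeBounds.lean`, `IrreducibleCountingThreshold.lean`)
  at rate `2p/3`. Consequence (Summits side, `Thresholds/DepolarizingThresholds.lean`): every pair of certified
  sector thresholds `p₀^X, p₀^Z` gives the certified depolarizing threshold `(3/2)·min(p₀^X, p₀^Z)`.

HONEST FRAMING: the `3/2` is the elementary marginal factor for decoders that IGNORE the `X`/`Z` correlation carried
by `Y` errors; it is a LOWER bound for that decoder class, not a statement about optimal (correlation-aware)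
decoding of depolarizing noise, and not a Monte Carlo number.

## References

* [DennisEtAl2002] E. Dennis, A. Kitaev, A. Landahl, J. Preskill, J. Math. Phys. 43 (2002) 4452, §4.1 (the error
  models; X and Z errors corrected separately; the depolarizing channel contrasted with the independent model).
* [DumerKovalevPryadko2015] I. Dumer, A. A. Kovalev, L. P. Pryadko, PRL 115 (2015) 050502, eq.
  (succesful-decoding-depolarizing) (CSS decoding succeeds iff both residuals are trivial).
* [AliferisGottesmanPreskill2006] P. Aliferis, D. Gottesman, J. Preskill, QIC 6 (2006) 97, §8.3 (ε/3 per Pauli).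
-/

noncomputable section

namespace Literature.InformationTheory.QuantumCodes

open Finset Literature.Computability.QuantumComplexity
open scoped NNReal ENNReal

/-! ### The depolarizing mass of a Pauli string -/

section Depolarizing

variable {Q : Type*} [Fintype Q]

/-- The single-letter depolarizing weight as a real: `I ↦ 1 - p`, `X, Y, Z ↦ p/3`.
[cite: AliferisGottesmanPreskill2006, §8.3 (each of the three Pauli errors weighted ε/3)] -/
def depolarizingLetter (p : ℝ) (P : Pauli) : ℝ := if P = Pauli.I then 1 - p else p / 3

/-- **Mass of the Pauli string `E` under i.i.d. depolarizing noise of rate `p`**: `∏_q (1-p)` over the clean qubits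
times `p/3` for each non-trivial letter. [cite: DennisEtAl2002, §4.1 (independent qubits; the depolarizing channel)] -/
def depolarizingProb (p : ℝ) (E : Q → Pauli) : ℝ := ∏ q, depolarizingLetter p (E q)

/-- The letter weights are non-negative for `0 ≤ p ≤ 1`. [cite: AliferisGottesmanPreskill2006, §8.3] -/
theorem depolarizingLetter_nonneg {p : ℝ} (hp0 : 0 ≤ p) (hp1 : p ≤ 1) (P : Pauli) : 0 ≤ depolarizingLetter p P := by
  unfold depolarizingLetter
  split_ifs
  · linarith
  · positivity

/-- The string mass is non-negative for `0 ≤ p ≤ 1`. [cite: DennisEtAl2002, §4.1] -/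
theorem depolarizingProb_nonneg {p : ℝ} (hp0 : 0 ≤ p) (hp1 : p ≤ 1) (E : Q → Pauli) : 0 ≤ depolarizingProb p E :=
  Finset.prod_nonneg fun q _ => depolarizingLetter_nonneg hp0 hp1 (E q)

/-- The real letter weight is the `ℝ≥0` weight of `PauliNoise.lean`. [cite: AliferisGottesmanPreskill2006, §8.3] -/
theorem coe_depolarizingWeight (p : ℝ≥0) (hp : p ≤ 1) (P : Pauli) :
    ((depolarizingWeight p P : ℝ≥0) : ℝ) = depolarizingLetter (p : ℝ) P := by
  cases P <;> simp [depolarizingWeight, depolarizingLetter, NNReal.coe_sub hp]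

/-- **Bridge to the `PMF`**: `depolarizingProb p E` is the mass of `E` under the product law
`iidLaw (depolarizingLaw p)` of `PauliNoise.lean`, read in `ℝ` — one number, two vocabularies.
[cite: DennisEtAl2002, §4.1 (independent errors on different qubits)] -/
theorem toReal_iidLaw_depolarizingLaw [DecidableEq Q] (p : ℝ≥0) (hp : p ≤ 1) (E : Q → Pauli) :
    (iidLaw (depolarizingLaw p hp) E).toReal = depolarizingProb (p : ℝ) E := by
  rw [iidLaw_apply]
  have hprod : (∏ q, depolarizingLaw p hp (E q)) = ((∏ q, depolarizingWeight p (E q) : ℝ≥0) : ℝ≥0∞) := by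
    rw [ENNReal.ofNNReal_finsetProd]
    exact Finset.prod_congr rfl fun q _ => rfl
  rw [hprod, ENNReal.coe_toReal, NNReal.coe_prod]
  exact Finset.prod_congr rfl fun q _ => coe_depolarizingWeight p hp (E q)

/-! ### The two marginals: independent flips of rate `2p/3` -/

/-- Letters with prescribed bit-flip part: `P(E_q ∈ {I, Z}) = 1 - 2p/3`, `P(E_q ∈ {X, Y}) = 2p/3`.
[cite: DennisEtAl2002, §4.1 (X errors: letters X and Y)] -/
theorem sum_depolarizingLetter_xBit (p : ℝ) (a : ZMod 2) :
    ∑ P ∈ univ.filter (fun P : Pauli => xBit P = a), depolarizingLetter p P =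
      if a = 0 then 1 - (2 * p / 3) else 2 * p / 3 := by
  have hset : ∀ a : ZMod 2, univ.filter (fun P : Pauli => xBit P = a) =
      if a = 0 then ({Pauli.I, Pauli.Z} : Finset Pauli) else {Pauli.X, Pauli.Y} := by decide
  rw [hset]
  have ha : a = 0 ∨ a = 1 := by revert a; decide
  rcases ha with rfl | rfl
  · simp only [if_true]
    rw [Finset.sum_pair (by decide)]
    simp [depolarizingLetter]
    ring
  · rw [if_neg (by decide), if_neg (by decide), Finset.sum_pair (by decide)]
    simp [depolarizingLetter]
    ring

/-- Letters with prescribed phase-flip part: `P(E_q ∈ {I, X}) = 1 - 2p/3`, `P(E_q ∈ {Y, Z}) = 2p/3`.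
[cite: DennisEtAl2002, §4.1 (Z errors: letters Z and Y)] -/
theorem sum_depolarizingLetter_zBit (p : ℝ) (a : ZMod 2) :
    ∑ P ∈ univ.filter (fun P : Pauli => zBit P = a), depolarizingLetter p P =
      if a = 0 then 1 - (2 * p / 3) else 2 * p / 3 := by
  have hset : ∀ a : ZMod 2, univ.filter (fun P : Pauli => zBit P = a) =
      if a = 0 then ({Pauli.I, Pauli.X} : Finset Pauli) else {Pauli.Y, Pauli.Z} := by decide
  rw [hset]
  have ha : a = 0 ∨ a = 1 := by revert a; decide
  rcases ha with rfl | rfl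
  · simp only [if_true]
    rw [Finset.sum_pair (by decide)]
    simp [depolarizingLetter]
    ring
  · rw [if_neg (by decide), if_neg (by decide), Finset.sum_pair (by decide)]
    simp [depolarizingLetter]
    ring

/-- `∏_q (x_q = 0 ? 1-r : r) = r^{|supp x|} (1-r)^{n - |supp x|}` — the Bernoulli weight of the support.
[cite: DennisEtAl2002, §4.4 eq. (prob_E)] -/
theorem prod_ite_eq_bernoulliWeight (r : ℝ) (x : Q → ZMod 2) :
    (∏ q, if x q = 0 then 1 - r else r) = bernoulliWeight r (supp x) := by
  classical
  rw [← Finset.prod_filter_mul_prod_filter_not univ (fun q => x q = 0)]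
  have h1 : (∏ q ∈ univ.filter (fun q => x q = 0), if x q = 0 then 1 - r else r) =
      ∏ q ∈ univ.filter (fun q => x q = 0), (1 - r) :=
    Finset.prod_congr rfl fun q hq => by rw [if_pos (mem_filter.1 hq).2]
  have h2 : (∏ q ∈ univ.filter (fun q => ¬ x q = 0), if x q = 0 then 1 - r else r) =
      ∏ q ∈ univ.filter (fun q => ¬ x q = 0), r :=
    Finset.prod_congr rfl fun q hq => by rw [if_neg (mem_filter.1 hq).2]
  rw [h1, h2, prod_const, prod_const]
  have hsupp : univ.filter (fun q => ¬ x q = 0) = supp x := by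
    ext q; simp [supp]
  have hcard : (univ.filter (fun q => x q = 0)).card = Fintype.card Q - (supp x).card := by
    rw [← hsupp]
    have := Finset.card_filter_add_card_filter_not (s := (univ : Finset Q)) (fun q => x q = 0)
    rw [Finset.card_univ] at this
    omega
  rw [hcard, hsupp, bernoulliWeight, mul_comm]

/-- **Bit-flip marginal of depolarizing noise**: for every set `A` of bit patterns, the depolarizing mass of the
strings whose `X`-part lies in `A` is the mass of `A` under INDEPENDENT flips of rate `2p/3`.
[cite: DennisEtAl2002, §4.1 (the depolarizing channel vs. independent bit flips)] -/
theorem sum_depolarizingProb_xBit_mem [DecidableEq Q] (p : ℝ) (A : Finset (Q → ZMod 2)) :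
    ∑ E ∈ univ.filter (fun E : Q → Pauli => (fun q => xBit (E q)) ∈ A), depolarizingProb p E =
      ∑ x ∈ A, bernoulliWeight (2 * p / 3) (supp x) := by
  classical
  -- sum fiberwise over the `X`-part
  rw [← Finset.sum_fiberwise_of_maps_to (s := univ.filter (fun E : Q → Pauli => (fun q => xBit (E q)) ∈ A))
    (t := A) (g := fun E q => xBit (E q)) (fun E hE => (mem_filter.1 hE).2)]
  refine Finset.sum_congr rfl fun x hx => ?_
  -- the fibre over `x` is the box `∏_q {P | xBit P = x q}`
  have hfib : (univ.filter (fun E : Q → Pauli => (fun q => xBit (E q)) ∈ A)).filter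
      (fun E => (fun q => xBit (E q)) = x) =
      Fintype.piFinset fun q => univ.filter (fun P : Pauli => xBit P = x q) := by
    ext E
    simp only [mem_filter, mem_univ, true_and, Fintype.mem_piFinset]
    constructor
    · rintro ⟨-, h⟩ q
      exact congrFun h q
    · intro h
      have hE : (fun q => xBit (E q)) = x := funext h
      exact ⟨hE ▸ hx, hE⟩
  rw [hfib]
  simp only [depolarizingProb]
  rw [← Finset.prod_univ_sum (t := fun q => univ.filter (fun P : Pauli => xBit P = x q))
    (f := fun _ P => depolarizingLetter p P)]
  rw [Finset.prod_congr rfl fun q _ => sum_depolarizingLetter_xBit p (x q)]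
  exact prod_ite_eq_bernoulliWeight (2 * p / 3) x

/-- **Phase-flip marginal of depolarizing noise**: the `Z`-part of a depolarizing error of rate `p` is a pattern
of INDEPENDENT flips of rate `2p/3`. [cite: DennisEtAl2002, §4.1 (the depolarizing channel vs. independent phase flips)] -/
theorem sum_depolarizingProb_zBit_mem [DecidableEq Q] (p : ℝ) (A : Finset (Q → ZMod 2)) :
    ∑ E ∈ univ.filter (fun E : Q → Pauli => (fun q => zBit (E q)) ∈ A), depolarizingProb p E =
      ∑ z ∈ A, bernoulliWeight (2 * p / 3) (supp z) := by
  classical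
  rw [← Finset.sum_fiberwise_of_maps_to (s := univ.filter (fun E : Q → Pauli => (fun q => zBit (E q)) ∈ A))
    (t := A) (g := fun E q => zBit (E q)) (fun E hE => (mem_filter.1 hE).2)]
  refine Finset.sum_congr rfl fun z hz => ?_
  have hfib : (univ.filter (fun E : Q → Pauli => (fun q => zBit (E q)) ∈ A)).filter
      (fun E => (fun q => zBit (E q)) = z) =
      Fintype.piFinset fun q => univ.filter (fun P : Pauli => zBit P = z q) := by
    ext E
    simp only [mem_filter, mem_univ, true_and, Fintype.mem_piFinset]
    constructor
    · rintro ⟨-, h⟩ q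
      exact congrFun h q
    · intro h
      have hE : (fun q => zBit (E q)) = z := funext h
      exact ⟨hE ▸ hz, hE⟩
  rw [hfib]
  simp only [depolarizingProb]
  rw [← Finset.prod_univ_sum (t := fun q => univ.filter (fun P : Pauli => zBit P = z q))
    (f := fun _ P => depolarizingLetter p P)]
  rw [Finset.prod_congr rfl fun q _ => sum_depolarizingLetter_zBit p (z q)]
  exact prod_ite_eq_bernoulliWeight (2 * p / 3) z

end Depolarizing

/-! ### Sector-wise decoding of a CSS code under depolarizing noise -/

namespace CSSCode

variable {RX RZ Q : Type*} [Fintype Q] [DecidableEq Q] [Fintype RX] [Fintype RZ]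

open Classical in
/-- **Failure probability of sector-wise decoding under i.i.d. depolarizing noise of rate `p`**: the decoder
`DX` of the `Z`-syndrome is applied to the bit-flip part `xBit ∘ E` of the Pauli error, `DZ` of the `X`-syndrome
to the phase-flip part `zBit ∘ E`; recovery fails iff one of the two residuals is not a stabilizer part
(`∉ rs H^X` resp. `∉ rs H^Z`). Definition. [cite: DumerKovalevPryadko2015, eq. (succesful-decoding-depolarizing)]
[cite: DennisEtAl2002, §4.1 (X and Z errors corrected separately)] -/
def depolarizingFailureProb (C : CSSCode RX RZ Q) (DX : Decoder (RZ → ZMod 2) (Q → ZMod 2))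
    (DZ : Decoder (RX → ZMod 2) (Q → ZMod 2)) (p : ℝ) : ℝ :=
  ∑ E ∈ univ.filter (fun E : Q → Pauli =>
      ¬ (DX.Corrects C.xSyndrome (C.rowSpX : Set (Q → ZMod 2)) (fun q => xBit (E q)) ∧
         DZ.Corrects C.zSyndrome (C.rowSpZ : Set (Q → ZMod 2)) (fun q => zBit (E q)))),
    depolarizingProb p E

open Classical in
/-- The depolarizing failure probability is non-negative (`0 ≤ p ≤ 1`). [cite: DennisEtAl2002, §4.1] -/
theorem depolarizingFailureProb_nonneg (C : CSSCode RX RZ Q) (DX : Decoder (RZ → ZMod 2) (Q → ZMod 2))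
    (DZ : Decoder (RX → ZMod 2) (Q → ZMod 2)) {p : ℝ} (hp0 : 0 ≤ p) (hp1 : p ≤ 1) :
    0 ≤ C.depolarizingFailureProb DX DZ p :=
  Finset.sum_nonneg fun E _ => depolarizingProb_nonneg hp0 hp1 E

open Classical in
/-- **The union bound for sector-wise decoding under depolarizing noise**: for `0 ≤ p ≤ 1`,
`P_fail^depol(p) ≤ P^X_fail(2p/3) + P^Z_fail(2p/3)`, where `P^X_fail(r) = Σ_{x : DX fails} r^{|x|}(1-r)^{n-|x|}`
is the bit-flip code-capacity failure probability of `DX` at flip rate `r` and `P^Z_fail` that of `DZ` (the two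
marginals of the depolarizing law are independent flips of rate `2p/3`; failure ⊆ X-failure ∪ Z-failure).
[cite: DennisEtAl2002, §4.1 (the two error types handled separately)] [cite: DumerKovalevPryadko2015, eq. (succesful-decoding-depolarizing)] -/
theorem depolarizingFailureProb_le (C : CSSCode RX RZ Q) (DX : Decoder (RZ → ZMod 2) (Q → ZMod 2))
    (DZ : Decoder (RX → ZMod 2) (Q → ZMod 2)) {p : ℝ} (hp0 : 0 ≤ p) (hp1 : p ≤ 1) :
    C.depolarizingFailureProb DX DZ p ≤
      (∑ x ∈ univ.filter (fun x : Q → ZMod 2 => ¬ DX.Corrects C.xSyndrome (C.rowSpX : Set (Q → ZMod 2)) x),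
          bernoulliWeight (2 * p / 3) (supp x)) +
        ∑ z ∈ univ.filter (fun z : Q → ZMod 2 => ¬ DZ.Corrects C.zSyndrome (C.rowSpZ : Set (Q → ZMod 2)) z),
          bernoulliWeight (2 * p / 3) (supp z) := by
  have hX := sum_depolarizingProb_xBit_mem p
    (univ.filter (fun x : Q → ZMod 2 => ¬ DX.Corrects C.xSyndrome (C.rowSpX : Set (Q → ZMod 2)) x))
  have hZ := sum_depolarizingProb_zBit_mem p
    (univ.filter (fun z : Q → ZMod 2 => ¬ DZ.Corrects C.zSyndrome (C.rowSpZ : Set (Q → ZMod 2)) z))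
  rw [← hX, ← hZ, depolarizingFailureProb]
  have hnn : ∀ E : Q → Pauli, 0 ≤ depolarizingProb p E := depolarizingProb_nonneg hp0 hp1
  -- failure ⊆ (X-part fails) ∪ (Z-part fails)
  have hsub : univ.filter (fun E : Q → Pauli =>
      ¬ (DX.Corrects C.xSyndrome (C.rowSpX : Set (Q → ZMod 2)) (fun q => xBit (E q)) ∧
         DZ.Corrects C.zSyndrome (C.rowSpZ : Set (Q → ZMod 2)) (fun q => zBit (E q)))) ⊆
      univ.filter (fun E : Q → Pauli => (fun q => xBit (E q)) ∈
          univ.filter (fun x : Q → ZMod 2 => ¬ DX.Corrects C.xSyndrome (C.rowSpX : Set (Q → ZMod 2)) x)) ∪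
        univ.filter (fun E : Q → Pauli => (fun q => zBit (E q)) ∈
          univ.filter (fun z : Q → ZMod 2 => ¬ DZ.Corrects C.zSyndrome (C.rowSpZ : Set (Q → ZMod 2)) z)) := by
    intro E hE
    simp only [mem_filter, mem_union, mem_univ, true_and] at hE ⊢
    by_cases h : DX.Corrects C.xSyndrome (C.rowSpX : Set (Q → ZMod 2)) (fun q => xBit (E q))
    · exact Or.inr fun h' => hE ⟨h, h'⟩
    · exact Or.inl h
  refine (Finset.sum_le_sum_of_subset_of_nonneg hsub fun E _ _ => hnn E).trans ?_
  rw [← Finset.sum_union_inter]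
  exact le_add_of_nonneg_right (Finset.sum_nonneg fun E _ => hnn E)

end CSSCode

end Literature.InformationTheory.QuantumCodes
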